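import Summits.BirchSwinnertonDyer.BirchSwinnertonDyer.Theorems.ThetaPartnerAtTwoSignedControlAtTwoArchMovesTwoTorsion
import Summits.BirchSwinnertonDyer.BirchSwinnertonDyer.Theorems.ThetaPartnerAtTwoSignedTransportAtTwoResidualArchimedean
import HarnessLib

/-!
# `Δ(E) < 0` ⟹ the archimedean decomposition group moves `E[2]` (the sub-row binder of the K4 archimedean doors)

Crux K4 `SignedControlAtTwo` (stmt-BirchSwinnertonDyer-20309), line `eulerchar` v12; width seat `bsd-wall-tp2-p3-w3` g8
(`--supports stmt-BirchSwinnertonDyer-20309`, helper).  The doors of `…ArchMovesTwoTorsion` / `…ShaTwoArchMoves`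
(`H³(ℚ, E[2]) = 0`, `H²(ℚ_∞, E[2]) = 0`, `Ш²(ℚ, E[2^∞]) = 0` from PT(a), the K4 body from PT(b)+PT(a)) carry the binder
«some element of `Γ_{ℚ_w}` moves a point of `E[2]`» (`hmove`, stated on `ρ_{E[2]}.toLocal (Sum.inl w)`).  This file supplies it
from the sign of the discriminant, as an ADAPTER of the tree theorem
`SignedTransportAtTwo.exists_smul_geomTorsion_two_ne_of_Δ_neg` (`…SignedTransportAtTwoResidualArchimedean.lean`: for `Δ < 0` the
non-trivial element of `Gal(ℚ̄_w/ℚ_w)` moves a `2`-torsion point — `δ = ∏(xᵢ − xⱼ)` would otherwise lie in `ℚ_w ≅ ℝ` with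
`16 δ² = Δ < 0`), re-keyed to `Place.Completion (Sum.inl w)` / `DiscreteGaloisModule.toLocal` (`toLocal_apply`,
`WeierstrassCurve.resGal_eq_absGaloisRestrict`):

* **`exists_toLocal_twoTorsion_ne_of_discriminant_neg`** — `W.Δ < 0` ⟹ `∃ σ ∈ Γ_{ℚ_w}, ∃ Q ∈ E[2], σ Q ≠ Q`;
* §2 the route-independent doors re-keyed on `W.Δ < 0`: **`subsingleton_galoisCohomology_three_twoTorsion_of_discriminant_neg`**
  (`H³(ℚ, E[2]) = 0` for `E(ℚ)[2] = 0`, `Δ < 0` — Milne I 4.10 (c) at `E[2]` on this half of the row) and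
  `subsingleton_galoisCohomology_two_toLocal_twoTorsion_of_discriminant_neg` (`H²(ℚ_∞, E[2]) = 0`).  The cone doors (`Ш² = 0`,
  the K4 body) are in `…ShaTwoArchMovesOfDiscriminantNeg.lean`.

HONEST FRAMING: THEOREMS only (no definition, no named fact, no `sorry`); closes no item; BSD is not proved by any of this.

References: [SilvermanAEC2009] III §1 (`Δ`, `b`-invariants); [Matsuno2008] Thm. 4.2 (as cited by the tree theorem); [MilneADT2006] I Thm. 4.10 (c), Thm. 2.13.
-/

set_option autoImplicit false
-- the Theorems namespace of this sub repeats the summit name by design (D-0017 nested layout)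
set_option linter.dupNamespace false

noncomputable section

namespace Summit.BirchSwinnertonDyer.BirchSwinnertonDyer.Theorems.SignedEC.ArchMoves

open Field NumberField WeierstrassCurve Literature.NumberTheory.GaloisRepresentations
open Literature.NumberTheory.EllipticCurves

/-! ## §1 `Δ < 0` ⟹ `Γ_{ℚ_w}` moves `E[2]` -/

section Rat

variable (W : WeierstrassCurve ℚ) [W.IsElliptic]

/-- **`Δ < 0` ⟹ the archimedean decomposition group moves `E[2]`**: for an elliptic curve `W/ℚ` with negative discriminant
and an infinite place `w` of `ℚ`, some `σ ∈ Γ_{ℚ_w}` moves some point of `E[2]` (through `ρ_{E[2]}.toLocal (inl w)`) — the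
binder `hmove` of the K4 archimedean doors.  Adapter of the tree's `SignedTransportAtTwo.exists_smul_geomTorsion_two_ne_of_Δ_neg`
(take `σ` the non-trivial element of `Gal(ℚ̄_w/ℚ_w)`, which has order `2`). [cite: SilvermanAEC2009, III §1] -/
theorem exists_toLocal_twoTorsion_ne_of_discriminant_neg (hΔ : W.Δ < 0) (w : InfinitePlace ℚ) :
    ∃ (σ : absoluteGaloisGroup (Place.Completion (Sum.inl w : Place ℚ))) (Q : W.geomTorsion ((2 : ℕ) : ℤ)),
      (W.torsionGaloisModule ((2 : ℕ) : ℤ)).toLocal (Sum.inl w) σ Q ≠ Q := by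
  -- a non-trivial element of `Gal(ℚ̄_w/ℚ_w)` (a group of order `2`)
  haveI : Finite (Field.absoluteGaloisGroup w.Completion) :=
    Nat.finite_of_card_ne_zero (by rw [SignedTransportAtTwo.natCard_absoluteGaloisGroup_completion w]; norm_num)
  have hnt : Nontrivial (Field.absoluteGaloisGroup w.Completion) := by
    rw [← Finite.one_lt_card_iff_nontrivial, SignedTransportAtTwo.natCard_absoluteGaloisGroup_completion w]
    norm_num
  obtain ⟨τ₀, hτ₀⟩ := exists_ne (1 : Field.absoluteGaloisGroup w.Completion)
  obtain ⟨P, hP⟩ := SignedTransportAtTwo.exists_smul_geomTorsion_two_ne_of_Δ_neg W hΔ w hτ₀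
  refine ⟨τ₀, P, ?_⟩
  rw [DiscreteGaloisModule.toLocal_apply, torsionGaloisModule_apply_apply]
  intro h
  apply hP
  rw [WeierstrassCurve.resGal_eq_absGaloisRestrict]
  exact h

end Rat

/-! ## §2 The route-independent archimedean doors re-keyed on `Δ < 0` -/

section Doors

variable (W : WeierstrassCurve ℚ) [W.IsElliptic]

/-- **`H³(ℚ, E[2]) = 0` for `E(ℚ)[2] = 0` and `Δ(E) < 0`** (Milne I 4.10 (c) at `M = E[2]`, proved on this half of the row).
[cite: MilneADT2006, Ch. I, Thm. 4.10 (c)] -/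
theorem subsingleton_galoisCohomology_three_twoTorsion_of_discriminant_neg
    (h0 : ∀ Q : W.geomTorsion ((2 : ℕ) : ℤ), Q ≠ 0 →
      ∃ g : absoluteGaloisGroup ℚ, W.torsionGaloisModule ((2 : ℕ) : ℤ) g Q ≠ Q)
    (hΔ : W.Δ < 0) : Subsingleton (galoisCohomology (W.torsionGaloisModule ((2 : ℕ) : ℤ)) 3) :=
  subsingleton_galoisCohomology_three_twoTorsion_of_moves W h0 Rat.infinitePlace
    (exists_toLocal_twoTorsion_ne_of_discriminant_neg W hΔ Rat.infinitePlace)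

/-- **`H²(Γ_{ℚ_w}, E[2]) = 0` for `Δ(E) < 0`** at every infinite place `w` of `ℚ` (Milne I Cor. 4.16 at `E[2]` is then trivial).
[cite: MilneADT2006, Ch. I, Thm. 2.13] -/
theorem subsingleton_galoisCohomology_two_toLocal_twoTorsion_of_discriminant_neg (hΔ : W.Δ < 0) (w : InfinitePlace ℚ) :
    Subsingleton (galoisCohomology ((W.torsionGaloisModule ((2 : ℕ) : ℤ)).toLocal (Sum.inl w)) 2) :=
  subsingleton_galoisCohomology_two_toLocal_twoTorsion_of_moves W w (exists_toLocal_twoTorsion_ne_of_discriminant_neg W hΔ w)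

end Doors

end Summit.BirchSwinnertonDyer.BirchSwinnertonDyer.Theorems.SignedEC.ArchMoves

end
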